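import Literature.Geometry.GeometricMeasureTheory.CubicalSubdivision
import Mathlib.MeasureTheory.Integral.Pi
import Mathlib.MeasureTheory.Measure.Lebesgue.EqHaar
import Mathlib.MeasureTheory.Measure.Haar.Unique
import Mathlib.Analysis.SpecialFunctions.Integrability.Basic
import Mathlib.MeasureTheory.Integral.Prod
import Mathlib.Analysis.SpecialFunctions.Pow.Real
import Mathlib.MeasureTheory.Function.SpecialFunctions.Basic
import HarnessLib

/-!
# The averaging lemma for the cubical retractions (Federer 4.2.7)

Support file for the proof of the named fact
`Literature.Geometry.GeometricMeasureTheory.Federer1969_compactness_integralCurrents`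
(Federer–Fleming compactness, [Federer1969, 4.2.17 (2)]), continuing
`CubicalSubdivision.lean`: the measure-theoretic input of the deformation theorem
[Federer1969, 4.2.9], Federer's Lemma 4.2.7 — for a finite (Radon) measure `ρ` on `ℝⁿ` the
translated singular densities `(u_m ∘ τ_a)⁻ᵐ` have controlled `ρ`-integral for many translations
`a ∈ A = [-1, 1]ⁿ` — in the inequality form that 4.2.9 uses, together with the choice of a good
translation for two measures at once (`‖T‖` and `‖∂T‖`). Model space `ℝⁿ = Fin n → ℝ` with
Lebesgue measure; everything is proved from Mathlib and `CubicalSubdivision.lean`.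

* `Cubical.u_add_two_mul` (`u_m` is `2ℤⁿ`-periodic), `Cubical.continuous_u`, `Cubical.upow m x =
  u_m(x)⁻ᵐ` (junk value `0` on `{u_m = 0}`, which is handled separately as a null set);
* `Cubical.integrableOn_upow` — **`u_m⁻ᵐ ∈ L¹([-2, 2]ⁿ)`**: off a null set
  `u_m⁻ᵐ ≤ Σ_{|I| = m+1} Π_{i ∈ I} |d(xᵢ)|^{-m/(m+1)}` (`Cubical.upow_le_sum_prod`, the `(m+1)`-th
  smallest value dominates each of the `m+1` smallest), and each product is integrable by Fubini on
  the product cube (`Integrable.fintype_prod`) and the one-dimensional integrability of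
  `|t - c|^{-s}`, `s < 1` (`Cubical.integrableOn_abs_offset_rpow`). (Federer evaluates
  `∫_A u_m⁻ᵐ = 2ⁿ (n choose m)` exactly; only finiteness is needed.)
* `Cubical.avgConst n m = ∫_{[-2,2]ⁿ} u_m⁻ᵐ`, `Cubical.setIntegral_upow_add_le` :
  `∫_A u_m(x₀ + a)⁻ᵐ da ≤ C(n, m)` for every `x₀` (periodicity + translation invariance);
* `Cubical.lintegral_lintegral_upow_le` — **4.2.7 (1) as an inequality**:
  `∫_A ∫ u_m(x + a)⁻ᵐ dρ(x) da ≤ C(n, m) ρ(ℝⁿ)` (Tonelli);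
* `Cubical.ae_measure_u_add_eq_zero` — for a.e. `a`, `ρ {x : u_m(x + a) = 0} = 0`
  (`{u_m = 0}` is Lebesgue-null, Fubini), i.e. "`‖T‖ {x : u_m[τ_a(x)] = 0} = 0`";
* `Cubical.volume_bad_le` (Markov) and `Cubical.exists_good_translate` — **4.2.7 (2)**: for finite
  measures `ρ₁, ρ₂` and `m₁, m₂` some `a ∈ A` has `ρ_j {u_{m_j} ∘ τ_a = 0} = 0` and
  `∫ (u_{m_j} ∘ τ_a)^{-m_j} dρ_j ≤ (4 C(n, m_j) / 2ⁿ) ρ_j(ℝⁿ)` for `j = 1, 2`.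

## References

* H. Federer, *Geometric Measure Theory*, Springer 1969, 4.2.7 and 4.2.9 (held copy
  `lit book:federernd-geometric-measure-theory`, PDF pp. 342–345) [Federer1969].
-/

noncomputable section

open Set Finset Function MeasureTheory Filter
open scoped Classical ENNReal

namespace Literature.Geometry.GeometricMeasureTheory

namespace Cubical

variable {n : ℕ}

/-! ### Periodicity and continuity of `u_m` -/

/-- `ẑ(t + 2k) = ẑ(t) + 2k`. [folklore] -/
theorem evenRound_add_two_mul (t : ℝ) (k : ℤ) : evenRound (t + 2 * k) = evenRound t + 2 * k := by
  rw [evenRound, evenRound, show (t + 2 * k) / 2 = t / 2 + k by ring, round_add_intCast]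
  ring

/-- `d(t + 2k) = d(t)`: the offset is `2ℤ`-periodic. [folklore] -/
theorem offset_add_two_mul (t : ℝ) (k : ℤ) : offset (t + 2 * k) = offset t := by
  rw [offset, offset, evenRound_add_two_mul]; push_cast; ring

/-- `u_m` is `2ℤⁿ`-periodic. [cite: Federer1969, 4.2.6] -/
theorem u_add_two_mul (m : ℕ) (x : Fin n → ℝ) (z : Fin n → ℤ) :
    u m (x + fun i => 2 * (z i : ℝ)) = u m x := by
  simp only [u, Pi.add_apply]
  simp_rw [offset_add_two_mul]

/-- `u_m` is `1`-Lipschitz, hence continuous. [cite: Federer1969, 4.2.6] -/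
theorem lipschitzWith_u (m : ℕ) : LipschitzWith 1 (u (n := n) m) :=
  LipschitzWith.of_dist_le_mul fun x y => by
    rw [Real.dist_eq, NNReal.coe_one, one_mul]; exact abs_u_sub_u_le m x y

/-- `u_m` is continuous. [cite: Federer1969, 4.2.6] -/
theorem continuous_u (m : ℕ) : Continuous (u (n := n) m) := (lipschitzWith_u m).continuous

/-- The density `u_m⁻ᵐ` (with the junk value `0⁻¹ = 0` where `u_m = 0`). [cite: Federer1969, 4.2.7] -/
def upow (m : ℕ) (x : Fin n → ℝ) : ℝ := (u m x)⁻¹ ^ m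

/-- `u_m⁻ᵐ ≥ 0`. [folklore] -/
theorem upow_nonneg (m : ℕ) (x : Fin n → ℝ) : 0 ≤ upow m x :=
  pow_nonneg (inv_nonneg.2 (u_nonneg m x)) m

/-- `u_m⁻ᵐ` is measurable. [folklore] -/
theorem measurable_upow (m : ℕ) : Measurable (upow (n := n) m) :=
  ((continuous_u m).measurable.inv).pow_const m

/-- `t ↦ |d(t)|` is continuous (`1`-Lipschitz). [folklore] -/
theorem continuous_offset_abs : Continuous fun t : ℝ => |offset t| := by
  have : LipschitzWith 1 fun t : ℝ => |offset t| :=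
    LipschitzWith.of_dist_le_mul fun t s => by
      rw [Real.dist_eq, NNReal.coe_one, one_mul, Real.dist_eq]; exact abs_abs_offset_sub_le t s
  exact this.continuous

/-! ### One-dimensional integrability of `|t - c|^{-s}` -/

/-- `t ↦ |t| ^ r` is integrable on bounded intervals for `-1 < r`. [folklore] -/
theorem integrableOn_abs_rpow_Icc {r : ℝ} (hr : -1 < r) (R : ℝ) :
    IntegrableOn (fun t : ℝ => |t| ^ r) (Icc (-R) R) := by
  rcases le_or_gt 0 R with hR | hR
  · have h1 : IntegrableOn (fun t : ℝ => |t| ^ r) (Icc 0 R) := by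
      have := (intervalIntegral.intervalIntegrable_rpow' hr (a := 0) (b := R))
      rw [intervalIntegrable_iff_integrableOn_Icc_of_le hR] at this
      exact this.congr_fun (fun t ht => by rw [abs_of_nonneg ht.1]) measurableSet_Icc
    have h2 : IntegrableOn (fun t : ℝ => |t| ^ r) (Icc (-R) 0) := by
      have hpre : (fun t : ℝ => -t) ⁻¹' Icc 0 R = Icc (-R) 0 := by
        ext t
        simp only [Set.mem_preimage, Set.mem_Icc]
        constructor <;> intro h <;> constructor <;> linarith
      have := ((Measure.measurePreserving_neg (volume : Measure ℝ)).integrableOn_comp_preimage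
        (Homeomorph.neg ℝ).measurableEmbedding).2 h1
      rw [hpre] at this
      exact this.congr_fun (fun t _ => by simp) measurableSet_Icc
    rw [show Icc (-R) R = Icc (-R) 0 ∪ Icc 0 R from (Set.Icc_union_Icc_eq_Icc (by linarith) hR).symm]
    exact h2.union h1
  · rw [Set.Icc_eq_empty (by linarith)]; exact integrableOn_empty

/-- `t ↦ |t - c| ^ r` is integrable on `[a, b]` for `-1 < r`. [folklore] -/
theorem integrableOn_abs_sub_rpow_Icc {r : ℝ} (hr : -1 < r) (c a b : ℝ) :
    IntegrableOn (fun t : ℝ => |t - c| ^ r) (Icc a b) := by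
  set R := max |a - c| |b - c| with hRdef
  have h1 := integrableOn_abs_rpow_Icc hr R
  have h2 := ((measurePreserving_sub_right (volume : Measure ℝ) c).integrableOn_comp_preimage
    (Homeomorph.subRight c).measurableEmbedding).2 h1
  refine h2.mono_set fun t ht => ?_
  simp only [Set.mem_preimage, Set.mem_Icc] at ht ⊢
  have ha : |a - c| ≤ R := le_max_left _ _
  have hb : |b - c| ≤ R := le_max_right _ _
  rw [abs_le] at ha hb
  constructor <;> linarith [ht.1, ht.2]

/-- On `[-2, 2]`: `|d(t)|^{-s} ≤ |t|^{-s} + |t - 2|^{-s} + |t + 2|^{-s}` (the nearest even integer is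
`-2`, `0` or `2`). [folklore] -/
theorem abs_offset_rpow_le {t : ℝ} (ht : t ∈ Icc (-2 : ℝ) 2) (s : ℝ) :
    |offset t| ^ (-s) ≤ |t| ^ (-s) + |t - 2| ^ (-s) + |t + 2| ^ (-s) := by
  have h0 : ∀ a : ℝ, 0 ≤ |a| ^ (-s) := fun a => Real.rpow_nonneg (abs_nonneg a) _
  have hr : round (t / 2) = -1 ∨ round (t / 2) = 0 ∨ round (t / 2) = 1 := by
    have h1 : -1 ≤ round (t / 2) := by
      rw [round_eq]; exact Int.le_floor.2 (by push_cast; linarith [ht.1])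
    have h2 : round (t / 2) ≤ 1 := by
      rw [round_eq]; exact Int.floor_le_iff.2 (by push_cast; linarith [ht.2])
    omega
  rw [offset, cast_evenRound]
  rcases hr with h | h | h <;> rw [h] <;> push_cast
  · rw [show t - 2 * (-1 : ℝ) = t + 2 by ring]; linarith [h0 t, h0 (t - 2)]
  · rw [mul_zero, sub_zero]; linarith [h0 (t - 2), h0 (t + 2)]
  · rw [mul_one]; linarith [h0 t, h0 (t + 2)]

/-- `t ↦ |d(t)|^{-s}` is integrable on `[-2, 2]` for `0 ≤ s < 1`. [folklore] -/
theorem integrableOn_abs_offset_rpow {s : ℝ} (hs : s < 1) :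
    IntegrableOn (fun t : ℝ => |offset t| ^ (-s)) (Icc (-2 : ℝ) 2) := by
  have hr : -1 < -s := by linarith
  have i0 : IntegrableOn (fun t : ℝ => |t| ^ (-s)) (Icc (-2 : ℝ) 2) := by
    simpa using integrableOn_abs_sub_rpow_Icc hr 0 (-2) 2
  have i2 : IntegrableOn (fun t : ℝ => |t - 2| ^ (-s)) (Icc (-2 : ℝ) 2) :=
    integrableOn_abs_sub_rpow_Icc hr 2 (-2) 2
  have im2 : IntegrableOn (fun t : ℝ => |t + 2| ^ (-s)) (Icc (-2 : ℝ) 2) := by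
    simpa using integrableOn_abs_sub_rpow_Icc hr (-2) (-2) 2
  have hint : IntegrableOn (fun t : ℝ => |t| ^ (-s) + |t - 2| ^ (-s) + |t + 2| ^ (-s))
      (Icc (-2 : ℝ) 2) := (i0.add i2).add im2
  refine Integrable.mono' hint ?_ ?_
  · exact ((continuous_offset_abs.measurable.pow_const _).aestronglyMeasurable)
  · rw [ae_restrict_iff' measurableSet_Icc]
    refine Eventually.of_forall fun t ht => ?_
    rw [Real.norm_eq_abs, abs_of_nonneg (Real.rpow_nonneg (abs_nonneg _) _)]
    exact abs_offset_rpow_le ht s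

/-! ### Integrability of `u_m⁻ᵐ` on cubes -/

/-- The coordinate even-lattice hyperplanes are Lebesgue-null: a.e. point has no coordinate in `2ℤ`. [folklore] -/
theorem ae_forall_offset_ne_zero : ∀ᵐ x : Fin n → ℝ, ∀ i, offset (x i) ≠ 0 := by
  have hnull : volume {x : Fin n → ℝ | ∃ i, offset (x i) = 0} = 0 := by
    have hsub : {x : Fin n → ℝ | ∃ i, offset (x i) = 0} ⊆
        ⋃ i : Fin n, ⋃ k : ℤ, {x : Fin n → ℝ | x i = 2 * k} := by
      intro x hx
      obtain ⟨i, hi⟩ := hx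
      refine Set.mem_iUnion.2 ⟨i, Set.mem_iUnion.2 ⟨round (x i / 2), ?_⟩⟩
      rw [offset, cast_evenRound, sub_eq_zero] at hi
      exact hi
    refine measure_mono_null hsub (measure_iUnion_null fun i => measure_iUnion_null fun k => ?_)
    rw [volume_pi]
    exact Measure.pi_hyperplane (fun _ => (volume : Measure ℝ)) i _
  rw [ae_iff]
  refine measure_mono_null (fun x hx => ?_) hnull
  simpa using hx

/-- The exponent `s = m/(m+1) ∈ [0, 1)`. [folklore] -/
def expo (m : ℕ) : ℝ := (m : ℝ) / (m + 1)

/-- `0 ≤ m/(m+1)`. [folklore] -/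
theorem expo_nonneg (m : ℕ) : 0 ≤ expo m := by unfold expo; positivity

/-- `m/(m+1) < 1`. [folklore] -/
theorem expo_lt_one (m : ℕ) : expo m < 1 := by
  unfold expo; rw [div_lt_one (by positivity)]; linarith

/-- `(m/(m+1)) (m+1) = m`. [folklore] -/
theorem expo_mul (m : ℕ) : expo m * (m + 1) = m := by
  unfold expo; field_simp

/-- **The pointwise product bound**: off the null set, `u_m(x)⁻ᵐ ≤ Σ_{|I| = m+1} Π_{i ∈ I} |d(xᵢ)|^{-m/(m+1)}`
(the `(m+1)`-th smallest value dominates the geometric mean over the minimising `(m+1)`-set).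
[folklore] -/
theorem upow_le_sum_prod {m : ℕ} (hm : m < n) {x : Fin n → ℝ} (hx : ∀ i, offset (x i) ≠ 0) :
    upow m x ≤ ∑ I ∈ (Finset.univ : Finset (Fin n)).powersetCard (m + 1),
      ∏ i ∈ I, |offset (x i)| ^ (-expo m) := by
  obtain ⟨I₀, hI₀, hu⟩ := exists_card_eq_kth hm fun i => |offset (x i)|
  have hI₀ne : I₀.Nonempty := Finset.card_pos.1 (by omega)
  have hv : ∀ i, 0 < |offset (x i)| := fun i => abs_pos.2 (hx i)
  have hupos : 0 < u m x := by
    obtain ⟨i, hi, hi'⟩ := exists_mem_eq_maxOn hI₀ne fun i => |offset (x i)|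
    rw [u, hu, hi']; exact hv i
  have hterm : ∀ I ∈ (Finset.univ : Finset (Fin n)).powersetCard (m + 1),
      0 ≤ ∏ i ∈ I, |offset (x i)| ^ (-expo m) := fun I _ =>
    Finset.prod_nonneg fun i _ => Real.rpow_nonneg (abs_nonneg _) _
  refine le_trans ?_ (Finset.single_le_sum hterm
    (Finset.mem_powersetCard.2 ⟨Finset.subset_univ _, hI₀⟩))
  -- on the minimising set: each factor `≥ u⁻ˢ`
  have hfac : ∀ i ∈ I₀, u m x ^ (-expo m) ≤ |offset (x i)| ^ (-expo m) := fun i hi =>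
    Real.rpow_le_rpow_of_nonpos (hv i) (by rw [u, hu]; exact le_maxOn (fun i => |offset (x i)|) hi)
      (neg_nonpos.2 (expo_nonneg m))
  have hpow : (u m x ^ (-expo m)) ^ (m + 1) = upow m x := by
    rw [← Real.rpow_natCast _ (m + 1), ← Real.rpow_mul hupos.le]
    push_cast
    rw [neg_mul, expo_mul, Real.rpow_neg hupos.le, Real.rpow_natCast, upow, inv_pow]
  calc upow m x = (u m x ^ (-expo m)) ^ (m + 1) := hpow.symm
    _ = ∏ _i ∈ I₀, u m x ^ (-expo m) := by rw [Finset.prod_const, hI₀]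
    _ ≤ ∏ i ∈ I₀, |offset (x i)| ^ (-expo m) :=
        Finset.prod_le_prod (fun i _ => Real.rpow_nonneg (u_nonneg m x) _) hfac

/-- The cube `Q = [-2, 2]ⁿ`. [folklore] -/
def bigCube (n : ℕ) : Set (Fin n → ℝ) := Set.pi Set.univ fun _ => Icc (-2 : ℝ) 2

/-- The cube `A = [-1, 1]ⁿ` of translations. [cite: Federer1969, 4.2.6] -/
def transCube (n : ℕ) : Set (Fin n → ℝ) := Set.pi Set.univ fun _ => Icc (-1 : ℝ) 1

/-- `Q` is measurable. [folklore] -/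
theorem measurableSet_bigCube : MeasurableSet (bigCube n) :=
  MeasurableSet.univ_pi fun _ => measurableSet_Icc

/-- `A` is measurable. [folklore] -/
theorem measurableSet_transCube : MeasurableSet (transCube n) :=
  MeasurableSet.univ_pi fun _ => measurableSet_Icc

/-- The products `Π_{i ∈ I} |d(xᵢ)|^{-s}` are integrable on the cube `Q`. [folklore] -/
theorem integrableOn_prod_rpow (m : ℕ) (I : Finset (Fin n)) :
    IntegrableOn (fun x : Fin n → ℝ => ∏ i ∈ I, |offset (x i)| ^ (-expo m)) (bigCube n) := by
  set f : Fin n → ℝ → ℝ := fun i t => if i ∈ I then |offset t| ^ (-expo m) else 1 with hf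
  have hfi : ∀ i, Integrable (f i) ((volume : Measure ℝ).restrict (Icc (-2 : ℝ) 2)) := by
    intro i
    by_cases hi : i ∈ I
    · simp only [hf, hi, if_true]
      exact integrableOn_abs_offset_rpow (expo_lt_one m)
    · simp only [hf, hi, if_false]
      exact integrableOn_const (by rw [Real.volume_Icc]; exact ENNReal.ofReal_ne_top)
  have hprod := Integrable.fintype_prod (ι := Fin n) hfi
  rw [IntegrableOn, bigCube, volume_pi, Measure.restrict_pi_pi]
  refine hprod.congr (Eventually.of_forall fun x => ?_)
  simp only [hf]
  rw [Finset.prod_ite_mem, Finset.univ_inter]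

/-- **`u_m⁻ᵐ` is integrable on the cube `[-2, 2]ⁿ`** (the finiteness of `∫_A u_m⁻ᵐ dℒⁿ` behind
4.2.7). [cite: Federer1969, 4.2.7] -/
theorem integrableOn_upow (m : ℕ) : IntegrableOn (upow (n := n) m) (bigCube n) := by
  by_cases hm : m < n
  · have hint : IntegrableOn (fun x : Fin n → ℝ => ∑ I ∈ (Finset.univ : Finset (Fin n)).powersetCard (m + 1),
        ∏ i ∈ I, |offset (x i)| ^ (-expo m)) (bigCube n) :=
      integrable_finsetSum _ fun I _ => integrableOn_prod_rpow m I
    refine Integrable.mono' hint (measurable_upow m).aestronglyMeasurable ?_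
    filter_upwards [ae_restrict_of_ae (ae_forall_offset_ne_zero (n := n))] with x hx
    rw [Real.norm_eq_abs, abs_of_nonneg (upow_nonneg m x)]
    exact upow_le_sum_prod hm hx
  · have : upow (n := n) m = fun _ => 1 := by
      ext x; rw [upow, u_of_le (not_lt.1 hm), inv_one, one_pow]
    rw [this]
    refine integrableOn_const ?_
    rw [bigCube, volume_pi_pi]
    simp [Real.volume_Icc]

/-- **Federer's constant**: `C(n, m) = ∫_{[-2,2]ⁿ} u_m⁻ᵐ dℒⁿ` (our stand-in for `2ⁿ (n choose m)`).
[cite: Federer1969, 4.2.7] -/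
def avgConst (n m : ℕ) : ℝ := ∫ x in bigCube n, upow m x

/-- `C(n, m) ≥ 0`. [folklore] -/
theorem avgConst_nonneg (n m : ℕ) : 0 ≤ avgConst n m :=
  setIntegral_nonneg measurableSet_bigCube fun x _ => upow_nonneg m x

/-- The periodic reduction `x₀' = (d(x₀ᵢ))ᵢ ∈ [-1, 1]ⁿ` of a point. [folklore] -/
def reducePt (x₀ : Fin n → ℝ) : Fin n → ℝ := fun i => offset (x₀ i)

/-- `|x₀'ᵢ| ≤ 1`. [folklore] -/
theorem abs_reducePt_le (x₀ : Fin n → ℝ) (i : Fin n) : |reducePt x₀ i| ≤ 1 := abs_offset_le_one _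

/-- `u_m(x₀ + a)⁻ᵐ = u_m(x₀' + a)⁻ᵐ` by `2ℤⁿ`-periodicity. [cite: Federer1969, 4.2.7] -/
theorem upow_add_eq (m : ℕ) (x₀ a : Fin n → ℝ) : upow m (x₀ + a) = upow m (reducePt x₀ + a) := by
  have e : x₀ + a = (reducePt x₀ + a) + fun i => 2 * ((round (x₀ i / 2) : ℤ) : ℝ) := by
    ext i
    simp only [Pi.add_apply, reducePt]
    have := offset_add_evenRound (x₀ i)
    rw [cast_evenRound] at this
    linarith
  rw [upow, upow, e, u_add_two_mul]

/-- `x₀' + A ⊆ Q` for `x₀' ∈ [-1, 1]ⁿ`. [folklore] -/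
theorem image_add_transCube_subset {x₀ : Fin n → ℝ} (h : ∀ i, |x₀ i| ≤ 1) :
    (fun a => x₀ + a) '' transCube n ⊆ bigCube n := by
  rintro _ ⟨a, ha, rfl⟩ i -
  have h1 := h i
  have h2 := ha i (Set.mem_univ _)
  simp only [Set.mem_Icc] at h2 ⊢
  rw [abs_le] at h1
  simp only [Pi.add_apply]
  constructor <;> linarith [h2.1, h2.2]

/-- Translations preserve Lebesgue measure. [folklore] -/
theorem measurePreserving_add_left' (x₀ : Fin n → ℝ) :
    MeasurePreserving (fun a : Fin n → ℝ => x₀ + a) volume volume :=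
  measurePreserving_add_left volume x₀

/-- Translations are measurable embeddings. [folklore] -/
theorem measurableEmbedding_add_left' (x₀ : Fin n → ℝ) :
    MeasurableEmbedding fun a : Fin n → ℝ => x₀ + a :=
  (Homeomorph.addLeft x₀).measurableEmbedding

/-- `a ↦ u_m(x₀ + a)⁻ᵐ` is integrable on `A`. [cite: Federer1969, 4.2.7] -/
theorem integrableOn_upow_add (m : ℕ) (x₀ : Fin n → ℝ) :
    IntegrableOn (fun a => upow m (x₀ + a)) (transCube n) := by
  simp_rw [upow_add_eq m x₀]
  set x₀' := reducePt x₀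
  have h1 : IntegrableOn (upow m) ((fun a => x₀' + a) '' transCube n) :=
    (integrableOn_upow m).mono_set (image_add_transCube_subset (abs_reducePt_le x₀))
  have h2 := ((measurePreserving_add_left' x₀').integrableOn_comp_preimage
    (measurableEmbedding_add_left' x₀')).2 h1
  rwa [(add_right_injective x₀').preimage_image] at h2

/-- **Translated averages are uniformly bounded**: `∫_A u_m(x₀ + a)⁻ᵐ da ≤ C(n, m)` for every `x₀`
(periodicity reduces `x₀` to `[-1, 1]ⁿ`, and then `x₀ + A ⊆ [-2, 2]ⁿ`). [cite: Federer1969, 4.2.7] -/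
theorem setIntegral_upow_add_le (m : ℕ) (x₀ : Fin n → ℝ) :
    ∫ a in transCube n, upow m (x₀ + a) ≤ avgConst n m := by
  simp_rw [upow_add_eq m x₀]
  set x₀' := reducePt x₀
  rw [← (measurePreserving_add_left' x₀').setIntegral_image_emb (measurableEmbedding_add_left' x₀')
    (upow m) (transCube n)]
  exact setIntegral_mono_set (integrableOn_upow m) (Eventually.of_forall fun x => upow_nonneg m x)
    (Eventually.of_forall (image_add_transCube_subset (abs_reducePt_le x₀)))

/-! ### The averaged bound (Tonelli) -/

/-- Joint measurability of `(a, x) ↦ u_m(x + a)⁻ᵐ`. [folklore] -/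
theorem measurable_ofReal_upow_add (m : ℕ) :
    Measurable fun p : (Fin n → ℝ) × (Fin n → ℝ) => ENNReal.ofReal (upow m (p.2 + p.1)) :=
  ENNReal.measurable_ofReal.comp ((measurable_upow m).comp (measurable_snd.add measurable_fst))

/-- **Federer's averaging identity, as an inequality**:
`∫_A ∫ u_m(x + a)⁻ᵐ dρ(x) da ≤ C(n, m) ρ(ℝⁿ)` for every finite measure `ρ`
("`∫_A ∫ (u_m ∘ τ_a)⁻ᵐ dρ dℒⁿ a = (n choose m) ρ(ℝⁿ) ℒⁿ(A)`"). [cite: Federer1969, 4.2.7 (1)] -/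
theorem lintegral_lintegral_upow_le (ρ : Measure (Fin n → ℝ)) [IsFiniteMeasure ρ] (m : ℕ) :
    ∫⁻ a in transCube n, ∫⁻ x, ENNReal.ofReal (upow m (x + a)) ∂ρ ≤
      ENNReal.ofReal (avgConst n m) * ρ Set.univ := by
  rw [lintegral_lintegral_swap ((measurable_ofReal_upow_add m).aemeasurable)]
  calc ∫⁻ x, ∫⁻ a in transCube n, ENNReal.ofReal (upow m (x + a)) ∂volume ∂ρ
      ≤ ∫⁻ _x, ENNReal.ofReal (avgConst n m) ∂ρ := by
        refine lintegral_mono fun x => ?_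
        rw [← ofReal_integral_eq_lintegral_ofReal (integrableOn_upow_add m x)
          (Eventually.of_forall fun a => upow_nonneg m _)]
        exact ENNReal.ofReal_le_ofReal (setIntegral_upow_add_le m x)
    _ = ENNReal.ofReal (avgConst n m) * ρ Set.univ := lintegral_const _

/-! ### Null sets: `u_m ∘ τ_a` vanishes only on a `ρ`-null set, for a.e. `a` -/

/-- `{∃ i, d(xᵢ) = 0}` is Lebesgue-null. [folklore] -/
theorem volume_exists_offset_eq_zero : volume {x : Fin n → ℝ | ∃ i, offset (x i) = 0} = 0 := by
  have h := ae_forall_offset_ne_zero (n := n)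
  rw [ae_iff] at h
  refine measure_mono_null (fun x hx => ?_) h
  simpa using hx

/-- `{u_m = 0}` is Lebesgue-null (it lies in `{∃ i, d(xᵢ) = 0}`). [cite: Federer1969, 4.2.6] -/
theorem volume_u_eq_zero (m : ℕ) : volume {b : Fin n → ℝ | u m b = 0} = 0 := by
  by_cases hm : m < n
  · refine measure_mono_null (fun b hb => ?_) volume_exists_offset_eq_zero
    obtain ⟨I₀, hI₀, hu⟩ := exists_card_eq_kth hm fun i => |offset (b i)|
    have hne : I₀.Nonempty := Finset.card_pos.1 (by omega)
    obtain ⟨i, hi⟩ := hne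
    refine ⟨i, abs_eq_zero.1 (le_antisymm ?_ (abs_nonneg _))⟩
    have h1 : |offset (b i)| ≤ u m b := by rw [u, hu]; exact le_maxOn (fun i => |offset (b i)|) hi
    rw [Set.mem_setOf_eq] at hb
    rwa [hb] at h1
  · have : {b : Fin n → ℝ | u m b = 0} = ∅ := by
      ext b; simp [u_of_le (not_lt.1 hm)]
    rw [this, measure_empty]

/-- **For a.e. translation the singular set is `ρ`-null**: `ρ {x : u_m(x + a) = 0} = 0` for
`ℒⁿ`-a.e. `a` (Fubini and translation invariance). [cite: Federer1969, 4.2.9] -/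
theorem ae_measure_u_add_eq_zero (ρ : Measure (Fin n → ℝ)) [SFinite ρ] (m : ℕ) :
    ∀ᵐ a : Fin n → ℝ, ρ {x | u m (x + a) = 0} = 0 := by
  set S : Set ((Fin n → ℝ) × (Fin n → ℝ)) := {p | u m (p.2 + p.1) = 0} with hSdef
  have hS : MeasurableSet S :=
    (isClosed_eq ((continuous_u m).comp (continuous_snd.add continuous_fst)) continuous_const).measurableSet
  have h1 : ((volume : Measure (Fin n → ℝ)).prod ρ) S = ∫⁻ a, ρ (Prod.mk a ⁻¹' S) :=
    Measure.prod_apply hS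
  have h2 : ((volume : Measure (Fin n → ℝ)).prod ρ) S =
      ∫⁻ x, volume ((fun a => (a, x)) ⁻¹' S) ∂ρ := Measure.prod_apply_symm hS
  have h3 : ∀ x, volume ((fun a : Fin n → ℝ => (a, x)) ⁻¹' S) = 0 := fun x => by
    have : (fun a : Fin n → ℝ => (a, x)) ⁻¹' S = (fun a => x + a) ⁻¹' {b | u m b = 0} := rfl
    rw [this, measure_preimage_add]
    exact volume_u_eq_zero m
  have h0 : ∫⁻ a, ρ (Prod.mk a ⁻¹' S) = 0 := by
    rw [← h1, h2, lintegral_congr h3, lintegral_zero]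
  exact (lintegral_eq_zero_iff (measurable_measure_prodMk_left hS)).1 h0

/-! ### Choice of a good translation -/

/-- `ℒⁿ(A) = 2ⁿ`. [folklore] -/
theorem volume_transCube : volume (transCube n) = ENNReal.ofReal (2 ^ n) := by
  rw [transCube, volume_pi_pi]
  simp only [Real.volume_Icc, Finset.prod_const, Finset.card_univ, Fintype.card_fin]
  rw [show (1 : ℝ) - -1 = 2 by norm_num, ENNReal.ofReal_pow (by norm_num)]

/-- **Markov step**: the translations `a ∈ A` where the averaged integral exceeds
`(4 C(n,m) / 2ⁿ) ρ(ℝⁿ)` have measure `≤ 2ⁿ/4`. [cite: Federer1969, 4.2.7 (2)] -/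
theorem volume_bad_le (ρ : Measure (Fin n → ℝ)) [IsFiniteMeasure ρ] (m : ℕ) :
    volume (transCube n ∩ {a | ¬(∫⁻ x, ENNReal.ofReal (upow m (x + a)) ∂ρ ≤
      ENNReal.ofReal (4 * avgConst n m / 2 ^ n) * ρ Set.univ)}) ≤ ENNReal.ofReal (2 ^ n / 4) := by
  set G : (Fin n → ℝ) → ℝ≥0∞ := fun a => ∫⁻ x, ENNReal.ofReal (upow m (x + a)) ∂ρ with hG
  have hGm : Measurable G := (measurable_ofReal_upow_add m).lintegral_prod_right'
  set C := avgConst n m with hCdef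
  set t : ℝ≥0∞ := ENNReal.ofReal (4 * C / 2 ^ n) * ρ Set.univ with ht
  -- degenerate cases: `t = 0` means `C ρ(univ) = 0`, and then `G = 0` a.e. on `A`
  by_cases ht0 : t = 0
  · have hCρ : ENNReal.ofReal C * ρ Set.univ = 0 := by
      rw [ht, mul_eq_zero] at ht0
      rcases ht0 with h | h
      · refine mul_eq_zero.2 (Or.inl ?_)
        rw [ENNReal.ofReal_eq_zero] at h ⊢
        have h4 : (0 : ℝ) < 4 / 2 ^ n := by positivity
        have e : 4 * C / 2 ^ n = C * (4 / 2 ^ n) := by ring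
        rw [e] at h
        nlinarith [avgConst_nonneg n m]
      · exact mul_eq_zero.2 (Or.inr h)
    have hint : ∫⁻ a in transCube n, G a = 0 :=
      le_antisymm ((lintegral_lintegral_upow_le ρ m).trans (by rw [hCρ])) bot_le
    have hae : ∀ᵐ a : Fin n → ℝ, a ∈ transCube n → G a = 0 := by
      have h1 := (lintegral_eq_zero_iff hGm).1 hint
      rw [Filter.EventuallyEq, ae_restrict_iff' measurableSet_transCube] at h1
      exact h1
    rw [ae_iff] at hae
    have h0 : volume (transCube n ∩ {a | ¬G a ≤ t}) = 0 := by
      refine measure_mono_null (fun a ha => ?_) hae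
      intro himp
      exact ha.2 (by rw [show G a = 0 from himp ha.1]; exact bot_le)
    exact le_of_eq_of_le h0 bot_le
  · have httop : t ≠ ⊤ := ENNReal.mul_ne_top ENNReal.ofReal_ne_top (measure_ne_top ρ _)
    -- Markov on `A`
    have hM := meas_ge_le_lintegral_div hGm.aemeasurable ht0 httop
      (μ := volume.restrict (transCube n))
    rw [Measure.restrict_apply' measurableSet_transCube] at hM
    calc volume (transCube n ∩ {a | ¬G a ≤ t})
        ≤ volume ({a | t ≤ G a} ∩ transCube n) := by
          refine measure_mono fun a ha => ⟨?_, ha.1⟩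
          exact (not_le.1 ha.2).le
      _ ≤ (∫⁻ a in transCube n, G a) / t := hM
      _ ≤ (ENNReal.ofReal C * ρ Set.univ) / t := by
          gcongr
          exact lintegral_lintegral_upow_le ρ m
      _ = ENNReal.ofReal (2 ^ n / 4) := by
          have hρ0 : ρ Set.univ ≠ 0 := by
            intro h; exact ht0 (by rw [ht, h, mul_zero])
          have hC0 : 0 < C := by
            rcases (avgConst_nonneg n m).lt_or_eq with h | h
            · exact h
            · exfalso; apply ht0; rw [ht, hCdef, ← h]; simp
          rw [ht, ENNReal.mul_div_mul_right _ _ hρ0 (measure_ne_top ρ _),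
            ← ENNReal.ofReal_div_of_pos (by positivity)]
          congr 1
          field_simp

/-- **Existence of a good translation** (Federer 4.2.7 (2) for two measures, combined with the
null-set statement of 4.2.9): for finite measures `ρ₁, ρ₂` on `ℝⁿ` and `m₁, m₂` there is
`a ∈ A = [-1, 1]ⁿ` such that, for `j = 1, 2`, `u_{m_j} ∘ τ_a` vanishes only on a `ρ_j`-null set and
`∫ (u_{m_j} ∘ τ_a)^{-m_j} dρ_j ≤ (4 C(n, m_j)/2ⁿ) ρ_j(ℝⁿ)`. [cite: Federer1969, 4.2.7 (2), 4.2.9] -/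
theorem exists_good_translate (ρ₁ ρ₂ : Measure (Fin n → ℝ)) [IsFiniteMeasure ρ₁]
    [IsFiniteMeasure ρ₂] (m₁ m₂ : ℕ) :
    ∃ a ∈ transCube n,
      ρ₁ {x | u m₁ (x + a) = 0} = 0 ∧ ρ₂ {x | u m₂ (x + a) = 0} = 0 ∧
      ∫⁻ x, ENNReal.ofReal (upow m₁ (x + a)) ∂ρ₁ ≤
        ENNReal.ofReal (4 * avgConst n m₁ / 2 ^ n) * ρ₁ Set.univ ∧
      ∫⁻ x, ENNReal.ofReal (upow m₂ (x + a)) ∂ρ₂ ≤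
        ENNReal.ofReal (4 * avgConst n m₂ / 2 ^ n) * ρ₂ Set.univ := by
  set B₁ := {a : Fin n → ℝ | ¬(∫⁻ x, ENNReal.ofReal (upow m₁ (x + a)) ∂ρ₁ ≤
      ENNReal.ofReal (4 * avgConst n m₁ / 2 ^ n) * ρ₁ Set.univ)}
  set B₂ := {a : Fin n → ℝ | ¬(∫⁻ x, ENNReal.ofReal (upow m₂ (x + a)) ∂ρ₂ ≤
      ENNReal.ofReal (4 * avgConst n m₂ / 2 ^ n) * ρ₂ Set.univ)}
  set N₁ := {a : Fin n → ℝ | ¬ρ₁ {x | u m₁ (x + a) = 0} = 0}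
  set N₂ := {a : Fin n → ℝ | ¬ρ₂ {x | u m₂ (x + a) = 0} = 0}
  have hN₁ : volume N₁ = 0 := by
    have := ae_measure_u_add_eq_zero ρ₁ m₁; rwa [ae_iff] at this
  have hN₂ : volume N₂ = 0 := by
    have := ae_measure_u_add_eq_zero ρ₂ m₂; rwa [ae_iff] at this
  have hB₁ := volume_bad_le ρ₁ m₁
  have hB₂ := volume_bad_le ρ₂ m₂
  -- the bad part of `A` has measure `< ℒⁿ(A)`
  have hbad : volume (transCube n ∩ (B₁ ∪ B₂ ∪ N₁ ∪ N₂)) < volume (transCube n) := by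
    calc volume (transCube n ∩ (B₁ ∪ B₂ ∪ N₁ ∪ N₂))
        ≤ volume (transCube n ∩ B₁) + volume (transCube n ∩ B₂) + volume N₁ + volume N₂ := by
          refine (measure_mono fun a ha => ?_).trans
            ((measure_union_le _ _).trans (add_le_add ((measure_union_le _ _).trans
              (add_le_add (measure_union_le _ _) le_rfl)) le_rfl))
          rcases ha.2 with ((h | h) | h) | h
          · exact Or.inl (Or.inl (Or.inl ⟨ha.1, h⟩))
          · exact Or.inl (Or.inl (Or.inr ⟨ha.1, h⟩))
          · exact Or.inl (Or.inr h)
          · exact Or.inr h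
      _ ≤ ENNReal.ofReal (2 ^ n / 4) + ENNReal.ofReal (2 ^ n / 4) + 0 + 0 := by
          gcongr
          · exact hN₁.le
          · exact hN₂.le
      _ < volume (transCube n) := by
          rw [add_zero, add_zero, volume_transCube, ← ENNReal.ofReal_add (by positivity) (by positivity),
            ENNReal.ofReal_lt_ofReal_iff (by positivity)]
          linarith [show (0 : ℝ) < 2 ^ n by positivity]
  -- hence some `a ∈ A` is good
  have hne : (transCube n \ (B₁ ∪ B₂ ∪ N₁ ∪ N₂)).Nonempty := by
    by_contra h
    rw [Set.not_nonempty_iff_eq_empty, Set.sdiff_eq_empty] at h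
    exact hbad.ne (by rw [Set.inter_eq_left.2 h])
  obtain ⟨a, haA, ha⟩ := hne
  simp only [Set.mem_union, not_or] at ha
  obtain ⟨⟨⟨hb₁, hb₂⟩, hn₁⟩, hn₂⟩ := ha
  exact ⟨a, haA, not_not.1 hn₁, not_not.1 hn₂, not_not.1 hb₁, not_not.1 hb₂⟩

end Cubical

end Literature.Geometry.GeometricMeasureTheory
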